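import Summits.RiemannHypothesis.RiemannHypothesis.Theorems.JensenPolynomialsFarGumbelCloser

/-!
# Route `JensenPolynomials`, FAR crux `XiWindowZeroFreeRelFar` (B1-rel far) — S3 step 6′: `stub_laplaceFar` MODULO the WANTED
list, v2 constants (RH-FREE; cell rh-jensen, HUMAN RULING D-0040)

Same as `FarGumbel.laplaceFar_of_wanted` (`JensenPolynomialsFarGumbelCloser.lean`) with theory g8's FLAG of 14:39:43Z applied
(item `stmt-RiemannHypothesis-19465`, stub S3): the saddle disc is `closedBall(υ + ξ₀/4, 1/(10υ²))` (ξ-radius `0.4ε²`, so that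
the contraction closes from the SEPARATED constants `|f′(ξ₀)| ≤ 0.2517ε²`, `|f″| ≥ 0.735`, `K₃ ≤ 2.58`), and the curvature
item reads `Re Ψ″ ≤ −10Λ`, `‖Ψ″‖ ≤ 27Λ`; the budget is re-run with `Re c ≥ 5Λ`, `‖c‖ ≤ (27/2)Λ` (`budget_quarter_v2`:
`√(2π/Re c) ≤ 1.13/√Λ`, `(π/‖c‖)^{1/2} ≥ 0.48/√Λ`, `M_cδ = 1.2Λ ≤ Re c/4`). Hypotheses `h0 … h5` = the six statements of
HOME `eng-4/S3/S3-WANTED.lean` v2 verbatim. WHAT THIS IS NOT: bookkeeping; nothing here bears on the zeros of `ζ` or RH.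
-/

noncomputable section
-- D-0017: `Summit.RiemannHypothesis.RiemannHypothesis.…` duplicates the namespace BY DESIGN (single-problem summit).
set_option linter.dupNamespace false

namespace Summit.RiemannHypothesis.RiemannHypothesis.Theorems.JensenPolynomials.FarGumbel

open Literature.NumberTheory.LFunctions MeasureTheory Set Filter Complex Metric
open Summit.RiemannHypothesis.RiemannHypothesis.Theorems.JensenPolynomials.WindowEGF
open scoped Real

/-- `√(2π/R) ≤ (113/100)/q` when `q² = Λ`, `q > 0` and `R ≥ 5Λ`. -/
theorem sqrt_two_pi_div_le_v2 {Λ q R : ℝ} (hq : q ^ 2 = Λ) (hq0 : 0 < q) (hR : 5 * Λ ≤ R) :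
    Real.sqrt (2 * π / R) ≤ 113 / 100 / q := by
  have hΛ : 0 < Λ := by rw [← hq]; positivity
  have hRpos : 0 < R := by linarith
  have hπ : π < 3.15 := Real.pi_lt_d2
  rw [Real.sqrt_le_left (by positivity)]
  rw [div_le_iff₀ hRpos]
  have : (113 / 100 / q) ^ 2 * R = (12769 / 10000) * R / Λ := by
    rw [← hq]; field_simp; ring
  rw [this, le_div_iff₀ hΛ]
  nlinarith

/-- `(12/25)/q ≤ (π/n)^{1/2}` when `q² = Λ`, `q > 0`, `0 < n ≤ (27/2)Λ`. -/
theorem le_rpow_half_pi_div_v2 {Λ q n : ℝ} (hq : q ^ 2 = Λ) (hq0 : 0 < q) (hn0 : 0 < n) (hn : n ≤ 27 / 2 * Λ) :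
    12 / 25 / q ≤ (π / n) ^ (1 / 2 : ℝ) := by
  have hπ : 3.14 < π := Real.pi_gt_d2
  rw [← Real.sqrt_eq_rpow]
  apply Real.le_sqrt_of_sq_le
  rw [le_div_iff₀ hn0]
  have : (12 / 25 / q) ^ 2 * n = (144 / 625) * n / Λ := by rw [← hq]; field_simp; ring
  rw [this, div_le_iff₀ (by rw [← hq]; positivity)]
  nlinarith

/-- **The budget with `θ = 1/4`.** Hypotheses: `q² = Λ`, `q ≥ 3000` (`Λ ≥ 9·10⁶`), `E > 0` (= `e^{Re Ψ(u_s)}`),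
`5Λ ≤ R ≤ n ≤ (27/2)Λ` (`R = Re c`, `n = ‖c‖`), `0 ≤ β ≤ 6` (= `‖b‖`), `0 ≤ η ≤ 1/474`, `1 ≤ ℓ ≤ 16/5`
(= `x_s − δ − (υ−2) + 1`), `|y| ≤ 1/10` (= `y_s`), `ρ ≥ −1` (= `Re(b²/4c)`). Conclusion: the `hbudget` hypothesis of
`laplaceFar_of_pointwise` with `M_c = 30Λ`, `δ = 1/25`, `A = Λ/500`, `E_conn = E·e^{−Λ}|y|`, `θ = 1/4`. -/
theorem budget_quarter_v2 {Λ q E R n β η ℓ y ρ : ℝ} (hq : q ^ 2 = Λ) (hq0 : 3000 ≤ q) (hE : 0 < E)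
    (hR : 5 * Λ ≤ R) (hRn : R ≤ n) (hn : n ≤ 27 / 2 * Λ) (hβ0 : 0 ≤ β) (hβ : β ≤ 6) (hη0 : 0 ≤ η) (hη : η ≤ 1 / 474)
    (hℓ0 : 1 ≤ ℓ) (hℓ : ℓ ≤ 16 / 5) (hy : |y| ≤ 1 / 10) (hρ : -1 ≤ ρ) :
    E * (Real.exp (β ^ 2 / R) * (4 * (30 * Λ) / R ^ 2 + Real.exp (-(R * (1 / 25) ^ 2 / 4)) * Real.sqrt (2 * π / R) +
        η * Real.sqrt (2 * π / R)) + (1 + η) * Real.exp (-(Λ / 500)) * ℓ) + Real.exp (Real.log E - Λ) * |y| ≤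
      1 / 4 * (Real.exp (Real.log E + ρ) * (π / n) ^ (1 / 2 : ℝ)) := by
  have hqpos : 0 < q := by linarith
  have hΛ : Λ = q ^ 2 := hq.symm
  have hΛpos : 0 < Λ := by rw [hΛ]; positivity
  have hΛ9 : 9000000 ≤ Λ := by
    have : (3000 : ℝ) ^ 2 ≤ q ^ 2 := pow_le_pow_left₀ (by norm_num) hq0 2
    rw [hΛ]; linarith
  have hRpos : 0 < R := by linarith
  have hnpos : 0 < n := by linarith
  -- two elementary exponential bounds (also in the tree as `Literature…Tao2016.exp_neg_le_inv` /
  -- `Literature…Automorphic.exp_neg_le_two_div_sq`; restated locally to keep the imports light)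
  have exp_neg_le_inv : ∀ {y : ℝ}, 0 < y → Real.exp (-y) ≤ 1 / y := by
    intro y hy
    have h1 : 1 + y ≤ Real.exp y := by linarith [Real.add_one_le_exp y]
    rw [Real.exp_neg, inv_eq_one_div]
    exact one_div_le_one_div_of_le hy (by linarith)
  have exp_neg_le_two_div_sq : ∀ {y : ℝ}, 0 < y → Real.exp (-y) ≤ 2 / y ^ 2 := by
    intro y hy
    have h1 : 1 + y + y ^ 2 / 2 ≤ Real.exp y := Real.quadratic_le_exp_of_nonneg hy.le
    have h2 : y ^ 2 / 2 ≤ Real.exp y := by nlinarith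
    rw [Real.exp_neg, inv_eq_one_div, div_le_div_iff₀ (Real.exp_pos y) (by positivity)]
    nlinarith
  -- transcendental pieces, one by one
  have h1 : Real.exp (β ^ 2 / R) ≤ 3 := by
    have hx : β ^ 2 / R ≤ 1 := by
      rw [div_le_one hRpos]; nlinarith
    calc Real.exp (β ^ 2 / R) ≤ Real.exp 1 := Real.exp_monotone hx
      _ ≤ 3 := Real.exp_one_lt_d9.le.trans (by norm_num)
  have h2 : 4 * (30 * Λ) / R ^ 2 ≤ 24 / 5 / Λ := by
    have hRR : (5 * Λ) * (5 * Λ) ≤ R * R := mul_le_mul hR hR (by positivity) (by positivity)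
    rw [div_le_div_iff₀ (by positivity) hΛpos]
    nlinarith [hRR, hΛpos]
  have h3 : Real.sqrt (2 * π / R) ≤ 113 / 100 / q := sqrt_two_pi_div_le_v2 hq hqpos hR
  have h4 : Real.exp (-(R * (1 / 25) ^ 2 / 4)) ≤ 2500 / R := by
    have := exp_neg_le_inv (y := R * (1 / 25) ^ 2 / 4) (by positivity)
    calc Real.exp (-(R * (1 / 25) ^ 2 / 4)) ≤ 1 / (R * (1 / 25) ^ 2 / 4) := this
      _ = 2500 / R := by field_simp; ring
  have h5 : Real.exp (-(Λ / 500)) ≤ 2 / (Λ / 500) ^ 2 := exp_neg_le_two_div_sq (by positivity)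
  have h6 : Real.exp (Real.log E - Λ) * |y| ≤ E * (1 / Λ) * (1 / 10) := by
    rw [Real.exp_sub, Real.exp_log hE]
    have : E / Real.exp Λ = E * Real.exp (-Λ) := by rw [Real.exp_neg]; ring
    rw [this]
    have hyn : 0 ≤ |y| := abs_nonneg y
    have := exp_neg_le_inv hΛpos
    calc E * Real.exp (-Λ) * |y| ≤ E * (1 / Λ) * |y| := by gcongr
      _ ≤ E * (1 / Λ) * (1 / 10) := by gcongr
  have h7 : 12 / 25 / q ≤ (π / n) ^ (1 / 2 : ℝ) := le_rpow_half_pi_div_v2 hq hqpos hnpos hn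
  have h8 : E * (1 / 3) ≤ Real.exp (Real.log E + ρ) := by
    rw [Real.exp_add, Real.exp_log hE]
    have : (1 : ℝ) / 3 ≤ Real.exp ρ := by
      calc (1 : ℝ) / 3 ≤ Real.exp (-1) := by
            rw [Real.exp_neg, inv_eq_one_div]
            exact one_div_le_one_div_of_le (Real.exp_pos 1) (Real.exp_one_lt_d9.le.trans (by norm_num))
        _ ≤ Real.exp ρ := Real.exp_monotone hρ
    exact mul_le_mul_of_nonneg_left this hE.le
  -- put the pieces together: LHS ≤ E·(stuff in 1/q, 1/Λ) and RHS ≥ E·(49/1200)/q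
  have hsq : 0 ≤ Real.sqrt (2 * π / R) := Real.sqrt_nonneg _
  have hexp1 : 0 ≤ Real.exp (β ^ 2 / R) := (Real.exp_pos _).le
  have hA : Real.exp (β ^ 2 / R) * (4 * (30 * Λ) / R ^ 2 + Real.exp (-(R * (1 / 25) ^ 2 / 4)) * Real.sqrt (2 * π / R) +
        η * Real.sqrt (2 * π / R)) ≤ 3 * (24 / 5 / Λ + (2500 / R) * (113 / 100 / q) + η * (113 / 100 / q)) := by
    have hin : 4 * (30 * Λ) / R ^ 2 + Real.exp (-(R * (1 / 25) ^ 2 / 4)) * Real.sqrt (2 * π / R) +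
        η * Real.sqrt (2 * π / R) ≤ 24 / 5 / Λ + (2500 / R) * (113 / 100 / q) + η * (113 / 100 / q) := by
      have t2 : Real.exp (-(R * (1 / 25) ^ 2 / 4)) * Real.sqrt (2 * π / R) ≤ (2500 / R) * (113 / 100 / q) :=
        mul_le_mul h4 h3 hsq (by positivity)
      have t3 : η * Real.sqrt (2 * π / R) ≤ η * (113 / 100 / q) := mul_le_mul_of_nonneg_left h3 hη0
      linarith
    have hin0 : 0 ≤ 4 * (30 * Λ) / R ^ 2 + Real.exp (-(R * (1 / 25) ^ 2 / 4)) * Real.sqrt (2 * π / R) +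
        η * Real.sqrt (2 * π / R) := by positivity
    calc _ ≤ 3 * (4 * (30 * Λ) / R ^ 2 + Real.exp (-(R * (1 / 25) ^ 2 / 4)) * Real.sqrt (2 * π / R) +
          η * Real.sqrt (2 * π / R)) := mul_le_mul_of_nonneg_right h1 hin0
      _ ≤ _ := by gcongr
  have hB : (1 + η) * Real.exp (-(Λ / 500)) * ℓ ≤ 2 * (2 / (Λ / 500) ^ 2) * (16 / 5) := by
    have : (1 + η) ≤ 2 := by linarith
    have hℓ' : 0 ≤ ℓ := by linarith
    calc (1 + η) * Real.exp (-(Λ / 500)) * ℓ ≤ 2 * (2 / (Λ / 500) ^ 2) * ℓ := by gcongr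
      _ ≤ 2 * (2 / (Λ / 500) ^ 2) * (16 / 5) := by gcongr
  -- reduce to an inequality in `q` alone
  have hR' : 2500 / R ≤ 2500 / (5 * Λ) := div_le_div_of_nonneg_left (by norm_num) (by positivity) hR
  have key : 3 * (24 / 5 / Λ + (2500 / (5 * Λ)) * (113 / 100 / q) + (1 / 474) * (113 / 100 / q)) +
      2 * (2 / (Λ / 500) ^ 2) * (16 / 5) + (1 / Λ) * (1 / 10) ≤ 1 / 4 * ((1 / 3) * (12 / 25 / q)) := by
    -- substitute `t = 1/q ∈ (0, 1/3000]`
    have ht0 : 0 < 1 / q := by positivity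
    have ht : 1 / q ≤ 1 / 3000 := one_div_le_one_div_of_le (by norm_num) hq0
    have e1 : 24 / 5 / Λ = 24 / 5 * (1 / q) ^ 2 := by rw [hΛ]; field_simp
    have e2 : 2500 / (5 * Λ) = 500 * (1 / q) ^ 2 := by rw [hΛ]; field_simp; ring
    have e3 : (113 : ℝ) / 100 / q = 113 / 100 * (1 / q) := by field_simp
    have e4 : 2 / (Λ / 500) ^ 2 = 500000 * (1 / q) ^ 4 := by rw [hΛ]; field_simp; ring
    have e5 : 1 / Λ = (1 / q) ^ 2 := by rw [hΛ]; field_simp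
    have e6 : (12 : ℝ) / 25 / q = 12 / 25 * (1 / q) := by field_simp
    rw [e1, e2, e3, e4, e5, e6]
    set t : ℝ := 1 / q with htdef
    have ht2 : t ^ 2 ≤ t / 3000 := by
      calc t ^ 2 = t * t := by ring
        _ ≤ t * (1 / 3000) := by gcongr
        _ = t / 3000 := by ring
    have ht3 : t ^ 3 ≤ t / 9000000 := by
      calc t ^ 3 = t * t ^ 2 := by ring
        _ ≤ t * (t / 3000) := by gcongr
        _ = t ^ 2 / 3000 := by ring
        _ ≤ (t / 3000) / 3000 := by gcongr
        _ = t / 9000000 := by ring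
    have ht4 : t ^ 4 = t * t ^ 3 := by ring
    have ht4' : t ^ 4 ≤ t / 27000000000 := by
      calc t ^ 4 = t * t ^ 3 := by ring
        _ ≤ t * (t / 9000000) := by gcongr
        _ = t ^ 2 / 9000000 := by ring
        _ ≤ (t / 3000) / 9000000 := by gcongr
        _ = t / 27000000000 := by ring
    have hgoal : 3 * (24 / 5 * t ^ 2 + 500 * t ^ 2 * (113 / 100 * t) + 1 / 474 * (113 / 100 * t)) +
        2 * (500000 * t ^ 4) * (16 / 5) + t ^ 2 * (1 / 10) ≤ 1 / 4 * (1 / 3 * (12 / 25 * t)) := by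
      have e : 500 * t ^ 2 * (113 / 100 * t) = 565 * t ^ 3 := by ring
      rw [e]
      linarith
    exact hgoal
  have hmid : 3 * (24 / 5 / Λ + (2500 / R) * (113 / 100 / q) + η * (113 / 100 / q)) + 2 * (2 / (Λ / 500) ^ 2) * (16 / 5) +
      (1 / Λ) * (1 / 10) ≤ 1 / 4 * ((1 / 3) * (12 / 25 / q)) := by
    have e1 : (2500 / R) * (113 / 100 / q) ≤ (2500 / (5 * Λ)) * (113 / 100 / q) :=
      mul_le_mul_of_nonneg_right hR' (by positivity)
    have e2 : η * (113 / 100 / q) ≤ (1 / 474) * (113 / 100 / q) := mul_le_mul_of_nonneg_right hη (by positivity)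
    linarith
  calc E * (Real.exp (β ^ 2 / R) * (4 * (30 * Λ) / R ^ 2 + Real.exp (-(R * (1 / 25) ^ 2 / 4)) * Real.sqrt (2 * π / R) +
          η * Real.sqrt (2 * π / R)) + (1 + η) * Real.exp (-(Λ / 500)) * ℓ) + Real.exp (Real.log E - Λ) * |y|
      ≤ E * (3 * (24 / 5 / Λ + (2500 / R) * (113 / 100 / q) + η * (113 / 100 / q)) + 2 * (2 / (Λ / 500) ^ 2) * (16 / 5)) +
          E * (1 / Λ) * (1 / 10) := by
        gcongr
    _ = E * (3 * (24 / 5 / Λ + (2500 / R) * (113 / 100 / q) + η * (113 / 100 / q)) + 2 * (2 / (Λ / 500) ^ 2) * (16 / 5) +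
          (1 / Λ) * (1 / 10)) := by ring
    _ ≤ E * (1 / 4 * ((1 / 3) * (12 / 25 / q))) := mul_le_mul_of_nonneg_left hmid hE.le
    _ = 1 / 4 * ((E * (1 / 3)) * (12 / 25 / q)) := by ring
    _ ≤ 1 / 4 * (Real.exp (Real.log E + ρ) * (π / n) ^ (1 / 2 : ℝ)) := by
        gcongr


/-- **S3 modulo the WANTED list v2** (disc radius `1/(10υ²)`, curvature `−10Λ / 27Λ`). -/
theorem laplaceFar_of_wanted_v2
    (h0 : ∀ z : ℂ, ‖z‖ ≤ (9 / 25 : ℝ) → ∀ ε : ℝ, 0 < ε → ε ≤ 20 / 189 →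
      |(farXi0 (farW z) ε).im| ≤ 39 / 100 ∧ |(farXi0 (farW z) ε).re| ≤ 1 / 2)
    (h1 : ∀ M : ℕ, 2 * 10 ^ 18 ≤ M → ∀ υ : ℝ,
      ((189 / 20 : ℝ) ≤ υ ∧ 4 * Real.pi * Real.exp (4 * υ) * υ = 2 * (M : ℝ) + 9 * υ) →
      ∀ a : ℂ, ‖a‖ ≤ (9 / 25 : ℝ) * υ ^ 2 →
      ∃ u_s : ℂ, ‖u_s - ((υ : ℂ) + farXi0 (farW (a / (υ : ℂ) ^ 2)) (1 / υ) / 4)‖ ≤ 1 / (10 * υ ^ 2) ∧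
        ‖farPsi1 M a u_s‖ ≤ 6)
    (h2 : ∀ M : ℕ, 2 * 10 ^ 18 ≤ M → ∀ υ : ℝ,
      ((189 / 20 : ℝ) ≤ υ ∧ 4 * Real.pi * Real.exp (4 * υ) * υ = 2 * (M : ℝ) + 9 * υ) →
      ∀ a : ℂ, ‖a‖ ≤ (9 / 25 : ℝ) * υ ^ 2 → ∀ u : ℂ,
      ‖u - ((υ : ℂ) + farXi0 (farW (a / (υ : ℂ) ^ 2)) (1 / υ) / 4)‖ ≤ 1 / (10 * υ ^ 2) →
      (farPsi2 M a u).re ≤ -10 * farLam υ ∧ ‖farPsi2 M a u‖ ≤ 27 * farLam υ ∧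
        |Real.log (‖farPsi2 M a u‖ / (16 * farLam υ * ‖farW (a / (υ : ℂ) ^ 2)‖))| ≤ 1 / 10)
    (h3 : ∀ M : ℕ, 2 * 10 ^ 18 ≤ M → ∀ υ : ℝ,
      ((189 / 20 : ℝ) ≤ υ ∧ 4 * Real.pi * Real.exp (4 * υ) * υ = 2 * (M : ℝ) + 9 * υ) →
      ∀ a : ℂ, ‖a‖ ≤ (9 / 25 : ℝ) * υ ^ 2 → ∀ u_s : ℂ,
      ‖u_s - ((υ : ℂ) + farXi0 (farW (a / (υ : ℂ) ^ 2)) (1 / υ) / 4)‖ ≤ 1 / (10 * υ ^ 2) →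
      (∀ x ∈ Set.Ioc (υ - 2) (u_s.re - 1 / 25),
          (farPsi M a (x + u_s.im * I) - farPsi M a (u_s.re + u_s.im * I)).re ≤ -(farLam υ / 500)) ∧
      (∀ x ∈ Set.Ioi (u_s.re + 1 / 25),
          (farPsi M a (x + u_s.im * I) - farPsi M a (u_s.re + u_s.im * I)).re ≤
            -(farLam υ / 500) - (x - (u_s.re + 1 / 25))))
    (h4 : ∀ M : ℕ, 2 * 10 ^ 18 ≤ M → ∀ υ : ℝ,
      ((189 / 20 : ℝ) ≤ υ ∧ 4 * Real.pi * Real.exp (4 * υ) * υ = 2 * (M : ℝ) + 9 * υ) →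
      ∀ a : ℂ, ‖a‖ ≤ (9 / 25 : ℝ) * υ ^ 2 → ∀ u_s : ℂ,
      ‖u_s - ((υ : ℂ) + farXi0 (farW (a / (υ : ℂ) ^ 2)) (1 / υ) / 4)‖ ≤ 1 / (10 * υ ^ 2) →
      ∀ t : ℝ, t ∈ Set.uIcc (0 : ℝ) u_s.im →
      ‖deBruijnPhiC ((υ - 2 : ℝ) + t * I) *
          ((((υ - 2 : ℝ) : ℂ) + t * I) * ((((υ - 2 : ℝ) : ℂ) + t * I) ^ 2 + a) ^ ((M : ℂ) - 1 / 2))‖ ≤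
        Real.exp ((farPsi M a u_s).re - farLam υ))
    (h5 : ∀ M : ℕ, 2 * 10 ^ 18 ≤ M → ∀ υ : ℝ,
      ((189 / 20 : ℝ) ≤ υ ∧ 4 * Real.pi * Real.exp (4 * υ) * υ = 2 * (M : ℝ) + 9 * υ) →
      ∀ a : ℂ, ‖a‖ ≤ (9 / 25 : ℝ) * υ ^ 2 → ∀ u : ℂ,
      ‖u - ((υ : ℂ) + farXi0 (farW (a / (υ : ℂ) ^ 2)) (1 / υ) / 4)‖ ≤ 1 / (10 * υ ^ 2) →
      |(farPsi M a u).re + 1 / 2 * (Real.log π - Real.log ‖farPsi2 M a u / 2‖) - farMain M υ (a / (υ : ℂ) ^ 2)| ≤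
        farLam υ / υ ^ 3 + 5) :
    ∀ M : ℕ, 2 * 10 ^ 18 ≤ M → ∀ υ : ℝ,
      ((189 / 20 : ℝ) ≤ υ ∧ 4 * Real.pi * Real.exp (4 * υ) * υ = 2 * (M : ℝ) + 9 * υ) →
      ∀ a : ℂ, ‖a‖ ≤ (9 / 25 : ℝ) * υ ^ 2 →
      winJ M υ a ≠ 0 ∧ |Real.log ‖winJ M υ a‖ - farMain M υ (a / (υ : ℂ) ^ 2)| ≤ farLam υ / υ ^ 3 + 6 := by
  intro M hM υ hυ a ha
  have hυ0 : (189 / 20 : ℝ) ≤ υ := hυ.1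
  have hυpos : 0 < υ := by linarith
  have hM1 : 1 ≤ M := le_trans (by norm_num) hM
  have hυ2 : (89 : ℝ) ≤ υ ^ 2 := by nlinarith only [hυ0]
  set Λ : ℝ := farLam υ with hΛdef
  have hΛ9 : 9000000 ≤ Λ := farLam_ge_nine_million υ hυ0
  have hΛpos : 0 < Λ := by linarith only [hΛ9]
  -- the reduced variable `z = a/υ²` and `ε = 1/υ`
  have hz : ‖a / (υ : ℂ) ^ 2‖ ≤ (9 / 25 : ℝ) := by
    rw [norm_div, norm_pow, Complex.norm_real, Real.norm_of_nonneg hυpos.le, div_le_iff₀ (by positivity)]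
    exact ha
  have hε : (0 : ℝ) < 1 / υ := by positivity
  have hε' : 1 / υ ≤ 20 / 189 := by rw [div_le_div_iff₀ hυpos (by norm_num)]; linarith only [hυ0]
  obtain ⟨hIm0, hRe0⟩ := h0 _ hz _ hε hε'
  -- the saddle point and its coordinates
  obtain ⟨u_s, hus, hb⟩ := h1 M hM υ hυ a ha
  set x_s : ℝ := u_s.re with hxs_def
  set y_s : ℝ := u_s.im with hys_def
  have huS : (x_s : ℂ) + y_s * I = u_s := Complex.re_add_im u_s
  have hr : 1 / (10 * υ ^ 2) ≤ (1 : ℝ) / 890 := by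
    apply one_div_le_one_div_of_le (by norm_num); nlinarith only [hυ2]
  have hcen_im : (((υ : ℂ) + farXi0 (farW (a / (υ : ℂ) ^ 2)) (1 / υ) / 4)).im =
      (farXi0 (farW (a / (υ : ℂ) ^ 2)) (1 / υ)).im / 4 := by simp
  have hcen_re : (((υ : ℂ) + farXi0 (farW (a / (υ : ℂ) ^ 2)) (1 / υ) / 4)).re =
      υ + (farXi0 (farW (a / (υ : ℂ) ^ 2)) (1 / υ)).re / 4 := by simp
  have hy : |y_s| ≤ 1 / 10 := by
    have h := (Complex.abs_im_le_norm _).trans hus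
    rw [Complex.sub_im, hcen_im] at h
    have h' := abs_le.mp h
    have h'' := abs_le.mp hIm0
    rw [abs_le]; constructor <;> linarith only [h'.1, h'.2, h''.1, h''.2, hr]
  have hx : |x_s - υ| ≤ 13 / 100 := by
    have h := (Complex.abs_re_le_norm _).trans hus
    rw [Complex.sub_re, hcen_re] at h
    have h' := abs_le.mp h
    have h'' := abs_le.mp hRe0
    rw [abs_le]; constructor <;> linarith only [h'.1, h'.2, h''.1, h''.2, hr]
  have hxs : υ - 2 ≤ x_s - 1 / 25 := by linarith only [(abs_le.mp hx).1]
  -- (W) the window from `‖Ψ‴‖ ≤ 180Λ`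
  have hK : ∀ x : ℝ, |x - x_s| ≤ 1 / 25 → ‖farPsi3 M a (x + y_s * I)‖ ≤ 180 * farLam υ := by
    intro x hxw
    refine norm_farPsi3_le M hM1 hυ ha ?_ hy
    have h1 := abs_le.mp hxw; have h2 := abs_le.mp hx
    rw [abs_le]; constructor <;> linarith only [h1.1, h1.2, h2.1, h2.2]
  have hT0 := window_of_farPsi3_le M hυ0 ha hy hxs hK
  have hT : ∀ x : ℝ, |x - x_s| ≤ 1 / 25 →
      ‖farPsi M a (x + y_s * I) - farPsi M a (x_s + y_s * I) - farPsi1 M a (x_s + y_s * I) * (x - x_s) +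
          (-(farPsi2 M a (x_s + y_s * I) / 2)) * (x - x_s) ^ 2‖ ≤ 30 * Λ * |x - x_s| ^ 3 := by
    intro x hxw
    have := hT0 x hxw
    rw [hΛdef]
    linarith only [this]
  -- the drift and the curvature at `u_s`
  set b : ℂ := farPsi1 M a (x_s + y_s * I) with hbdef
  set c : ℂ := -(farPsi2 M a (x_s + y_s * I) / 2) with hcdef
  have hb' : ‖b‖ ≤ 6 := by rw [hbdef, huS]; exact hb
  obtain ⟨hc_re, hc_norm, -⟩ := h2 M hM υ hυ a ha u_s hus
  have hcre : c.re = -(farPsi2 M a u_s).re / 2 := by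
    rw [hcdef, huS]
    have : farPsi2 M a u_s / 2 = ((1 / 2 : ℝ) : ℂ) * farPsi2 M a u_s := by push_cast; ring
    rw [this, Complex.neg_re, Complex.re_ofReal_mul]; ring
  have hcn : ‖c‖ = ‖farPsi2 M a u_s‖ / 2 := by
    rw [hcdef, huS, norm_neg, norm_div]; simp
  have hRc : 5 * Λ ≤ c.re := by rw [hcre]; linarith only [hc_re]
  have hnc : ‖c‖ ≤ 27 / 2 * Λ := by rw [hcn]; linarith only [hc_norm]
  have hRn : c.re ≤ ‖c‖ := Complex.re_le_norm c
  have hc : 0 < c.re := by linarith only [hRc, hΛpos]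
  have hc0 : c ≠ 0 := fun h => by rw [h, Complex.zero_re] at hc; exact lt_irrefl _ hc
  -- (Q) the amplitude
  have hη : Real.exp (-4 * (υ - 2)) ≤ 1 / 474 := by
    have h1 : Real.exp (-4 * (υ - 2)) ≤ Real.exp (-(149 / 5)) := Real.exp_monotone (by linarith only [hυ0])
    have h2 : 1 + 149 / 5 + (149 / 5) ^ 2 / 2 ≤ Real.exp (149 / 5) := Real.quadratic_le_exp_of_nonneg (by norm_num)
    have h3 : Real.exp (-(149 / 5 : ℝ)) ≤ 1 / 474 := by
      rw [Real.exp_neg, inv_eq_one_div]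
      exact one_div_le_one_div_of_le (by norm_num) (by linarith only [h2])
    exact h1.trans h3
  have hQ : ∀ x : ℝ, υ - 2 ≤ x → ‖deBruijnPhiC (x + y_s * I) / phiHead (x + y_s * I) - 1‖ ≤ Real.exp (-4 * (υ - 2)) :=
    fun x hxx => norm_phiRatio_sub_one_le hυ0 hxx hy
  -- (D) descent and (C) connector
  obtain ⟨hL, hR⟩ := h3 M hM υ hυ a ha u_s hus
  have hconn := connector_le_of_pointwise M (υ := υ) (a := a) (y_s := y_s)
    (B := Real.exp ((farPsi M a (x_s + y_s * I)).re - Λ)) (fun t ht => by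
      have := h4 M hM υ hυ a ha u_s hus t ht
      rw [huS]; exact this)
  -- the budget
  set E : ℝ := Real.exp (farPsi M a (x_s + y_s * I)).re with hEdef
  have hEpos : 0 < E := Real.exp_pos _
  have hlogE : Real.log E = (farPsi M a (x_s + y_s * I)).re := Real.log_exp _
  set ρ : ℝ := (b ^ 2 / (4 * c)).re with hρdef
  have hρabs : |ρ| ≤ 1 / 2 := by
    have h1 : |ρ| ≤ ‖b ^ 2 / (4 * c)‖ := Complex.abs_re_le_norm _
    have h2 : ‖b ^ 2 / (4 * c)‖ = ‖b‖ ^ 2 / (4 * ‖c‖) := by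
      rw [norm_div, norm_pow, norm_mul]; simp
    rw [h2] at h1
    have hcpos : 0 < ‖c‖ := lt_of_lt_of_le hc hRn
    have hb36 : ‖b‖ ^ 2 ≤ 36 := by
      have h0 : 0 ≤ ‖b‖ := norm_nonneg b
      have := pow_le_pow_left₀ h0 hb' 2
      linarith only [this]
    have hc4 : (72 : ℝ) ≤ 4 * ‖c‖ := by linarith only [hRc, hRn, hΛ9]
    have h3 : ‖b‖ ^ 2 / (4 * ‖c‖) ≤ 1 / 2 := by
      rw [div_le_iff₀ (by positivity)]
      linarith only [hb36, hc4]
    exact h1.trans h3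
  have hρ : -1 ≤ ρ := by have := abs_le.mp hρabs; linarith only [this]
  have hq : Real.sqrt Λ ^ 2 = Λ := Real.sq_sqrt hΛpos.le
  have hq0 : (3000 : ℝ) ≤ Real.sqrt Λ := by
    rw [show (3000 : ℝ) = Real.sqrt (3000 ^ 2) by rw [Real.sqrt_sq (by norm_num)]]
    exact Real.sqrt_le_sqrt (by linarith only [hΛ9])
  have hℓ0 : (1 : ℝ) ≤ x_s - 1 / 25 - (υ - 2) + 1 := by linarith only [hxs]
  have hℓ : x_s - 1 / 25 - (υ - 2) + 1 ≤ 16 / 5 := by linarith only [(abs_le.mp hx).2]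
  have hB := budget_quarter_v2 (E := E) (y := y_s) (ρ := ρ) (β := ‖b‖) (η := Real.exp (-4 * (υ - 2)))
    (ℓ := x_s - 1 / 25 - (υ - 2) + 1) hq hq0 hEpos hRc hRn hnc (norm_nonneg _) hb' (Real.exp_pos _).le hη
    hℓ0 hℓ hy hρ
  rw [hlogE] at hB
  have hbudget : Real.exp (farPsi M a (x_s + y_s * I)).re *
        (Real.exp (‖b‖ ^ 2 / c.re) * (4 * (30 * Λ) / c.re ^ 2 + Real.exp (-(c.re * (1 / 25) ^ 2 / 4)) *
          Real.sqrt (2 * π / c.re) + Real.exp (-4 * (υ - 2)) * Real.sqrt (2 * π / c.re)) +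
          (1 + Real.exp (-4 * (υ - 2))) * Real.exp (-(Λ / 500)) * (x_s - 1 / 25 - (υ - 2) + 1)) +
        Real.exp ((farPsi M a (x_s + y_s * I)).re - Λ) * |y_s| ≤
      1 / 4 * (Real.exp (farPsi M a (x_s + y_s * I) + b ^ 2 / (4 * c)).re * (π / ‖c‖) ^ (1 / 2 : ℝ)) := by
    rw [Complex.add_re]
    exact hB
  -- the master reduction
  obtain ⟨hne, hlog⟩ := laplaceFar_of_pointwise M hM1 hυ0 ha (x_s := x_s) (y_s := y_s) (δ := 1 / 25)
    (Mc := 30 * Λ) (A := Λ / 500) (η := Real.exp (-4 * (υ - 2)))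
    (Econn := Real.exp ((farPsi M a (x_s + y_s * I)).re - Λ) * |y_s|) (θ := 1 / 4) (b := b) (c := c)
    hy hc (by norm_num) hxs (by positivity) (by linarith only [hRc, hΛpos]) (Real.exp_pos _).le (by norm_num) (by norm_num)
    hT hQ hL hR hconn hbudget
  refine ⟨hne, ?_⟩
  -- the value comparison (L5) and the bookkeeping `2θ + |ρ| + (Λε³ + 5) ≤ Λε³ + 6`
  have hval := h5 M hM υ hυ a ha u_s hus
  have hcn' : ‖c‖ = ‖farPsi2 M a u_s / 2‖ := by rw [hcdef, huS, norm_neg]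
  have hΨeq : (farPsi M a (x_s + y_s * I)).re = (farPsi M a u_s).re := by rw [huS]
  rw [Complex.add_re, hΨeq, hcn'] at hlog
  have hρ' : |(b ^ 2 / (4 * c)).re| ≤ 1 / 2 := hρabs
  have habs1 := abs_le.mp hlog
  have habs2 := abs_le.mp hval
  have habs3 := abs_le.mp hρ'
  rw [abs_le]
  constructor
  · linarith only [habs1.1, habs2.1, habs3.1, habs3.2]
  · linarith only [habs1.2, habs2.2, habs3.1, habs3.2]

end Summit.RiemannHypothesis.RiemannHypothesis.Theorems.JensenPolynomials.FarGumbel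

end
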